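import Mathlib
import Summits.CriticalPhenomena.CardyFormulaZ2.Theorems.CardySelfRefinementDefs
import HarnessLib

/-!
# Two-scale summation for stub `stub_boundaryRelevance` (line `far-field-is-a-quarter-turn`,
crux `TrivialSectorRate`, stmt-CriticalPhenomena-10266)

(HB), the boundary-relevance input `hB` of the mass theorems of the line, follows from its
restriction to the lattice scales `D ≥ 1`, `Dη < 1` (`boundaryRelevance_of_small_scales`,
`…StubBoundaryRelevanceCounting.lean`).  The sufficient condition of that file,
`boundaryRelevance_small_of_count_of_decay`, asks for a UNIFORM per-box decay
`M(Rel u D) ≤ C (Dη)^{1+b}` of the boundary boxes, which fails even for polygonal quads: a box at a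
reflex marked corner (interior angle `α > π`) or at a transversal crossing of two quad boundaries
is relevant with probability `≍ (Dη)^{π/α}`, exponent `< 1`.  This file proves the corrected
TWO-SCALE reduction.  Fix a finite exceptional set `P ⊂ ℂ` (corners, segment endpoints, pairwise
boundary crossings) and a clearance constant `A ≥ 2`; write `x = Dη` and
`ℓ_u = infDist(η·z(k•u), P)` (plane distance from the drawn block centre to `P`).  Then the bound
`∑_{u ∈ U, bdist u < 2x} M_k(γ s)(Rel u D) ≤ C D² x^β`, `β > 0` — EXACTLY the hypothesis `h` of
`boundaryRelevance_of_small_scales` — follows from (`boundaryRelevance_small_of_twoScale`)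

* (count) `#{u ∈ U : bdist u < 2x, ℓ_u < ℓ} ≤ L D η⁻¹ min(ℓ, 1)` for all levels `ℓ ≥ 2x` (for
  polygonal families and any finite nonempty `P`: the `2x`-tube about the pieces of `∂F` within
  `ℓ` of a point of `P` holds `O(ℓ D/η)` block centres, the whole tube `O(D/η)`);
* (corner) `M(Rel u D) ≤ C x^c` (`c > 0`) for the boundary blocks with `ℓ_u < A x` (a positive
  wedge / crossing arm exponent at the exceptional points);
* (two-scale) for every level `ℓ ≥ A x`, the boundary blocks with `ℓ_u ≥ ℓ` have
  `M(Rel u D) ≤ C (x / min(ℓ,1))^{1+b} min(ℓ,1)^c` (`b, c > 0`: half-plane three arms from scale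
  `x` to `ℓ`, exponent `1 + b > 1`, then the wedge exponent `c` from `ℓ` to `1`).

The bookkeeping is the abstract `sum_le_of_twoScale_count` (inner ball, far blocks, and the dyadic
shells `2^j A x ≤ ℓ_u < 2^{j+1} A x` below `1`, summed geometrically); `β = min(c_corner, c, b/2)`.
Pure real analysis: no percolation estimate and no quad regularity is proved or used here.
-/

noncomputable section

namespace Summit.CriticalPhenomena.CardyFormulaZ2.Theorems.CardySelfRefinement.FarField

open scoped Topology
open Filter Set MeasureTheory
open Literature.Probability.LatticeModels Literature.Probability.Percolation
open Literature.Probability.Percolation.QuadCrossing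
open Summit.CriticalPhenomena.CardyFormulaZ2.Theses.CardySelfRefinement

/-! ## Real-variable lemmas -/

/-- `t · t^{σ-1} = t^σ` for `t > 0`. -/
theorem mul_rpow_sub_one {t : ℝ} (ht : 0 < t) (σ : ℝ) : t * t ^ (σ - 1) = t ^ σ := by
  rw [Real.rpow_sub ht, Real.rpow_one]
  field_simp

/-! ## The abstract two-scale summation -/

/-- **ABSTRACT TWO-SCALE SUMMATION.**  Let `S` be a finite set carrying a size `f ≥ 0` and a level
`ℓ ≥ 0`, and let `a > 0`, `N, E₁, E₂, G ≥ 0`, `σ < 0`.  Assume: (count) for every `t ≥ a` the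
elements of level `< t` number `≤ N min(t, 1)`; (inner) elements of level `< a` have size `≤ E₁`;
(far) elements of level `≥ max(a, 1)` have size `≤ E₂`; (mid) for every `t ∈ [a, 1)` the elements
of level `≥ t` have size `≤ G t^{σ-1}`.  Then `∑_S f ≤ N a E₁ + N E₂ + 2 N G a^σ / (1 - 2^σ)`: the
inner ball, the far elements, and the dyadic shells `2^j a ≤ ℓ < 2^{j+1} a` below level `1`
(`≤ 2 N 2^j a` elements of size `≤ G (2^j a)^{σ-1}`, total `2 N G a^σ (2^σ)^j`, a geometric
series). -/
theorem sum_le_of_twoScale_count {α : Type*} (S : Finset α) (f ℓ : α → ℝ)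
    (hf : ∀ u ∈ S, 0 ≤ f u) (hℓ : ∀ u ∈ S, 0 ≤ ℓ u) {a N E₁ E₂ G σ : ℝ} (ha : 0 < a)
    (hN : 0 ≤ N) (hE₁ : 0 ≤ E₁) (hE₂ : 0 ≤ E₂) (hG : 0 ≤ G) (hσ : σ < 0)
    (hcount : ∀ t : ℝ, a ≤ t → ((S.filter (fun u => ℓ u < t)).card : ℝ) ≤ N * min t 1)
    (hin : ∀ u ∈ S, ℓ u < a → f u ≤ E₁)
    (hfar : ∀ u ∈ S, a ≤ ℓ u → 1 ≤ ℓ u → f u ≤ E₂)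
    (hmid : ∀ t : ℝ, a ≤ t → t < 1 → ∀ u ∈ S, t ≤ ℓ u → f u ≤ G * t ^ (σ - 1)) :
    ∑ u ∈ S, f u ≤ N * a * E₁ + N * E₂ + 2 * N * G * a ^ σ * (1 - (2 : ℝ) ^ σ)⁻¹ := by
  -- the geometric ratio
  obtain ⟨q, hqdef⟩ : ∃ x : ℝ, x = (2 : ℝ) ^ σ := ⟨_, rfl⟩
  obtain ⟨hq0, hq1⟩ : 0 ≤ q ∧ q < 1 := ⟨hqdef ▸ Real.rpow_nonneg (by norm_num) _,
    hqdef ▸ Real.rpow_lt_one_of_one_lt_of_neg (by norm_num) hσ⟩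
  rw [← hqdef]
  -- (1) the inner ball `ℓ < a`
  have hinner : ∑ u ∈ S.filter (fun u => ℓ u < a), f u ≤ N * a * E₁ := by
    have hcard : ((S.filter (fun u => ℓ u < a)).card : ℝ) ≤ N * a :=
      (hcount a le_rfl).trans (mul_le_mul_of_nonneg_left (min_le_left _ _) hN)
    calc ∑ u ∈ S.filter (fun u => ℓ u < a), f u
        ≤ (S.filter (fun u => ℓ u < a)).card • E₁ :=
          Finset.sum_le_card_nsmul _ _ _ fun u hu =>
            hin u (Finset.mem_filter.1 hu).1 (Finset.mem_filter.1 hu).2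
      _ = ((S.filter (fun u => ℓ u < a)).card : ℝ) * E₁ := by rw [nsmul_eq_mul]
      _ ≤ N * a * E₁ := mul_le_mul_of_nonneg_right hcard hE₁
  -- (2) the far elements `ℓ ≥ max(a, 1)`
  have hfarsum : ∑ u ∈ S.filter (fun u => a ≤ ℓ u ∧ 1 ≤ ℓ u), f u ≤ N * E₂ := by
    set Sf := S.filter (fun u => a ≤ ℓ u ∧ 1 ≤ ℓ u) with hSf
    obtain ⟨T, hTdef⟩ : ∃ x : ℝ, x = ∑ u ∈ S, ℓ u + a + 1 := ⟨_, rfl⟩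
    have hsub : Sf ⊆ S.filter (fun u => ℓ u < T) := by
      intro u hu
      rw [hSf, Finset.mem_filter] at hu
      have : ℓ u ≤ ∑ v ∈ S, ℓ v := Finset.single_le_sum hℓ hu.1
      exact Finset.mem_filter.2 ⟨hu.1, by rw [hTdef]; linarith⟩
    have hT : a ≤ T := by have := Finset.sum_nonneg hℓ; rw [hTdef]; linarith
    have hcard : (Sf.card : ℝ) ≤ N :=
      calc (Sf.card : ℝ) ≤ ((S.filter (fun u => ℓ u < T)).card : ℝ) := by
            exact_mod_cast Finset.card_le_card hsub
        _ ≤ N * min T 1 := hcount T hT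
        _ ≤ N * 1 := mul_le_mul_of_nonneg_left (min_le_right _ _) hN
        _ = N := mul_one N
    calc ∑ u ∈ Sf, f u ≤ Sf.card • E₂ :=
          Finset.sum_le_card_nsmul _ _ _ fun u hu => by
            rw [hSf] at hu
            obtain ⟨huS, h1, h2⟩ := Finset.mem_filter.1 hu
            exact hfar u huS h1 h2
      _ = (Sf.card : ℝ) * E₂ := by rw [nsmul_eq_mul]
      _ ≤ N * E₂ := mul_le_mul_of_nonneg_right hcard hE₂
  -- (3) the dyadic shells `2^j a ≤ ℓ < 2^{j+1} a` below level `1`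
  have hshell : ∀ j : ℕ,
      ∑ u ∈ S.filter (fun u => 2 ^ j * a ≤ ℓ u ∧ ℓ u < 2 * (2 ^ j * a) ∧ ℓ u < 1), f u ≤
        2 * N * G * a ^ σ * q ^ j := by
    intro j
    set Sj := S.filter (fun u => 2 ^ j * a ≤ ℓ u ∧ ℓ u < 2 * (2 ^ j * a) ∧ ℓ u < 1) with hSj
    have hta : a ≤ 2 ^ j * a := le_mul_of_one_le_left ha.le (one_le_pow₀ one_le_two)
    have ht0 : 0 < 2 ^ j * a := by positivity
    have hcard : (Sj.card : ℝ) ≤ N * (2 * (2 ^ j * a)) := by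
      have hsub : Sj ⊆ S.filter (fun u => ℓ u < 2 * (2 ^ j * a)) := by
        intro u hu
        rw [hSj, Finset.mem_filter] at hu
        exact Finset.mem_filter.2 ⟨hu.1, hu.2.2.1⟩
      calc (Sj.card : ℝ) ≤ ((S.filter (fun u => ℓ u < 2 * (2 ^ j * a))).card : ℝ) := by
            exact_mod_cast Finset.card_le_card hsub
        _ ≤ N * min (2 * (2 ^ j * a)) 1 := hcount _ (by linarith)
        _ ≤ N * (2 * (2 ^ j * a)) := mul_le_mul_of_nonneg_left (min_le_left _ _) hN
    have hterm : ∀ u ∈ Sj, f u ≤ G * (2 ^ j * a) ^ (σ - 1) := by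
      intro u hu
      rw [hSj] at hu
      obtain ⟨huS, hlo, -, hlt1⟩ := Finset.mem_filter.1 hu
      exact hmid (2 ^ j * a) hta (lt_of_le_of_lt hlo hlt1) u huS hlo
    have hGt : 0 ≤ G * (2 ^ j * a) ^ (σ - 1) := mul_nonneg hG (Real.rpow_nonneg ht0.le _)
    calc ∑ u ∈ Sj, f u
        ≤ Sj.card • (G * (2 ^ j * a) ^ (σ - 1)) := Finset.sum_le_card_nsmul _ _ _ hterm
      _ = (Sj.card : ℝ) * (G * (2 ^ j * a) ^ (σ - 1)) := by rw [nsmul_eq_mul]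
      _ ≤ N * (2 * (2 ^ j * a)) * (G * (2 ^ j * a) ^ (σ - 1)) :=
          mul_le_mul_of_nonneg_right hcard hGt
      _ = 2 * N * G * ((2 ^ j * a) * (2 ^ j * a) ^ (σ - 1)) := by ring
      _ = 2 * N * G * (q ^ j * a ^ σ) := by
          -- `(2^j a)^σ = (2^σ)^j a^σ` (cf. `two_pow_mul_rpow`, NymanBeurlingRateLargeOrdinates)
          rw [mul_rpow_sub_one ht0, Real.mul_rpow (by positivity) ha.le, ← Real.rpow_natCast 2 j,
            ← Real.rpow_mul (by norm_num), mul_comm (j : ℝ) σ, Real.rpow_mul (by norm_num),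
            Real.rpow_natCast, hqdef]
      _ = 2 * N * G * a ^ σ * q ^ j := by ring
  -- (4) every element is inner, far, or in a shell `j < J`
  obtain ⟨T, hTdef⟩ : ∃ x : ℝ, x = (∑ u ∈ S, ℓ u) / a + 1 := ⟨_, rfl⟩
  obtain ⟨J, hJ⟩ := pow_unbounded_of_one_lt T (one_lt_two : (1 : ℝ) < 2)
  have hcover : ∀ u ∈ S, f u ≤ (if ℓ u < a then f u else 0) +
      (if a ≤ ℓ u ∧ 1 ≤ ℓ u then f u else 0) +
      ∑ j ∈ Finset.range J,
        (if 2 ^ j * a ≤ ℓ u ∧ ℓ u < 2 * (2 ^ j * a) ∧ ℓ u < 1 then f u else 0) := by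
    intro u hu
    have hfu := hf u hu
    have hite : ∀ p : Prop, ∀ _ : Decidable p, 0 ≤ (if p then f u else 0) := fun p _ => by
      split_ifs <;> [exact hfu; exact le_rfl]
    have h2 := hite (a ≤ ℓ u ∧ 1 ≤ ℓ u) inferInstance
    have hterm0 : ∀ j, 0 ≤ (if 2 ^ j * a ≤ ℓ u ∧ ℓ u < 2 * (2 ^ j * a) ∧ ℓ u < 1 then f u else 0) :=
      fun j => hite _ _
    have h3 : 0 ≤ ∑ j ∈ Finset.range J,
        (if 2 ^ j * a ≤ ℓ u ∧ ℓ u < 2 * (2 ^ j * a) ∧ ℓ u < 1 then f u else 0) :=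
      Finset.sum_nonneg fun j _ => hterm0 j
    by_cases hina : ℓ u < a
    · rw [if_pos hina]
      linarith
    · rw [if_neg hina, zero_add]
      have hale : a ≤ ℓ u := not_lt.1 hina
      by_cases hone : 1 ≤ ℓ u
      · rw [if_pos ⟨hale, hone⟩]
        linarith
      · rw [if_neg (fun h => hone h.2), zero_add]
        have hlt1 : ℓ u < 1 := not_le.1 hone
        obtain ⟨y, hydef⟩ : ∃ z : ℝ, z = ℓ u / a := ⟨_, rfl⟩
        have hy1 : 1 ≤ y := by rw [hydef, le_div_iff₀ ha]; linarith
        obtain ⟨n, hn1, hn2⟩ := exists_nat_pow_near hy1 one_lt_two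
        have hyT : y < T := by
          have h2' : y ≤ (∑ v ∈ S, ℓ v) / a :=
            hydef ▸ div_le_div_of_nonneg_right (Finset.single_le_sum hℓ hu) ha.le
          rw [hTdef]
          linarith
        have hnJ : n < J :=
          (pow_lt_pow_iff_right₀ one_lt_two).1 (lt_of_le_of_lt hn1 (hyT.trans hJ))
        have hshell_n : 2 ^ n * a ≤ ℓ u ∧ ℓ u < 2 * (2 ^ n * a) ∧ ℓ u < 1 := by
          refine ⟨?_, ?_, hlt1⟩
          · have := mul_le_mul_of_nonneg_right hn1 ha.le
            rwa [hydef, div_mul_cancel₀ _ ha.ne'] at this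
          · have := mul_lt_mul_of_pos_right hn2 ha
            rw [hydef, div_mul_cancel₀ _ ha.ne', pow_succ] at this
            linarith
        calc f u = (if 2 ^ n * a ≤ ℓ u ∧ ℓ u < 2 * (2 ^ n * a) ∧ ℓ u < 1 then f u else 0) := by
              rw [if_pos hshell_n]
          _ ≤ ∑ j ∈ Finset.range J,
              (if 2 ^ j * a ≤ ℓ u ∧ ℓ u < 2 * (2 ^ j * a) ∧ ℓ u < 1 then f u else 0) :=
            Finset.single_le_sum
              (f := fun j => (if 2 ^ j * a ≤ ℓ u ∧ ℓ u < 2 * (2 ^ j * a) ∧ ℓ u < 1 then f u else 0))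
              (fun j _ => hterm0 j) (Finset.mem_range.2 hnJ)
  -- (5) assemble
  have hgeomsum : ∑ j ∈ Finset.range J, q ^ j ≤ (1 - q)⁻¹ :=
    sum_le_hasSum (Finset.range J) (fun j _ => pow_nonneg hq0 j)
      (hasSum_geometric_of_lt_one hq0 hq1)
  calc ∑ u ∈ S, f u
      ≤ ∑ u ∈ S, ((if ℓ u < a then f u else 0) + (if a ≤ ℓ u ∧ 1 ≤ ℓ u then f u else 0) +
          ∑ j ∈ Finset.range J,
            (if 2 ^ j * a ≤ ℓ u ∧ ℓ u < 2 * (2 ^ j * a) ∧ ℓ u < 1 then f u else 0)) :=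
        Finset.sum_le_sum hcover
    _ = ∑ u ∈ S.filter (fun u => ℓ u < a), f u +
          ∑ u ∈ S.filter (fun u => a ≤ ℓ u ∧ 1 ≤ ℓ u), f u +
          ∑ j ∈ Finset.range J,
            ∑ u ∈ S.filter (fun u => 2 ^ j * a ≤ ℓ u ∧ ℓ u < 2 * (2 ^ j * a) ∧ ℓ u < 1), f u := by
        rw [Finset.sum_add_distrib, Finset.sum_add_distrib, Finset.sum_comm, Finset.sum_filter,
          Finset.sum_filter]
        congr 1
        exact Finset.sum_congr rfl fun j _ => (Finset.sum_filter _ _).symm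
    _ ≤ N * a * E₁ + N * E₂ + ∑ j ∈ Finset.range J, 2 * N * G * a ^ σ * q ^ j :=
        add_le_add (add_le_add hinner hfarsum) (Finset.sum_le_sum fun j _ => hshell j)
    _ = N * a * E₁ + N * E₂ + 2 * N * G * a ^ σ * ∑ j ∈ Finset.range J, q ^ j := by
        rw [Finset.mul_sum]
    _ ≤ N * a * E₁ + N * E₂ + 2 * N * G * a ^ σ * (1 - q)⁻¹ := by
        gcongr

/-! ## The two-scale reduction of the small-scale boundary relevance -/

/-- **SMALL-SCALE BOUNDARY RELEVANCE FROM A TWO-SCALE COUNT, A CORNER BOUND AND A TWO-SCALE DECAY**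
(registered helper of `stub_boundaryRelevance`; see the module docstring).  For a parameter path
`γ`, a finite quad family `F`, a finite exceptional set `P ⊂ ℂ` and a clearance constant `A ≥ 2`,
writing `x = Dη` and `ℓ_u = infDist(η·z(k•u), P)`: if at the scales `D ≥ 1`, `x < 1` (small `η`)
(count) `#{u ∈ U : bdist u < 2x, ℓ_u < ℓ} ≤ L D η⁻¹ min(ℓ,1)` for every level `ℓ ≥ 2x`,
(corner) the boundary blocks with `ℓ_u < A x` have `M_k(γ s)(Rel u D) ≤ C x^c`, `c > 0`, and
(two-scale) for every level `ℓ ≥ A x` the boundary blocks with `ℓ_u ≥ ℓ` have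
`M_k(γ s)(Rel u D) ≤ C (x / min(ℓ,1))^{1+b} min(ℓ,1)^c`, `b, c > 0`, all uniformly in `s`, then
`∑_{u ∈ U, bdist u < 2x} M_k(γ s)(Rel u D) ≤ C' D² x^{β}` with `β = min(c_corner, c, b/2) > 0` — the
hypothesis `h` of `boundaryRelevance_of_small_scales`, whence (HB). -/
theorem boundaryRelevance_small_of_twoScale {k : ℕ} (γ : unitInterval → ℝ × ℝ) (m : ℕ)
    (F : Fin m → Quad (univ : Set ℂ)) (P : Finset ℂ) {A : ℝ} (hA : 2 ≤ A)
    (hcount : ∃ L η₁ : ℝ, 0 < η₁ ∧ ∀ η ∈ Set.Ioo (0 : ℝ) η₁, ∀ (D : ℕ), 1 ≤ D → (D : ℝ) * η < 1 →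
        ∀ ℓ : ℝ, 2 * D * η ≤ ℓ → ∀ U : Finset (Site 2),
          ((U.filter (fun u => bdist k m F η u < 2 * D * η ∧
              Metric.infDist ((η : ℂ) * squareLatticeEmbedding.z (ctr k u)) (P : Set ℂ) < ℓ)).card :
            ℝ) ≤ L * D * η⁻¹ * min ℓ 1)
    (hcorner : ∃ c C η₂ : ℝ, 0 < c ∧ 0 < η₂ ∧ ∀ (s : unitInterval), ∀ η ∈ Set.Ioo (0 : ℝ) η₂,
        ∀ (D : ℕ), 1 ≤ D → (D : ℝ) * η < 1 → ∀ u : Site 2, bdist k m F η u < 2 * D * η →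
          Metric.infDist ((η : ℂ) * squareLatticeEmbedding.z (ctr k u)) (P : Set ℂ) < A * D * η →
            (M k (γ s).1 (γ s).2).real (Rel k m F η u D) ≤ C * ((D : ℝ) * η) ^ c)
    (htwo : ∃ b c C η₃ : ℝ, 0 < b ∧ 0 < c ∧ 0 < η₃ ∧ ∀ (s : unitInterval), ∀ η ∈ Set.Ioo (0 : ℝ) η₃,
        ∀ (D : ℕ), 1 ≤ D → (D : ℝ) * η < 1 → ∀ ℓ : ℝ, A * D * η ≤ ℓ → ∀ u : Site 2,
          bdist k m F η u < 2 * D * η →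
            ℓ ≤ Metric.infDist ((η : ℂ) * squareLatticeEmbedding.z (ctr k u)) (P : Set ℂ) →
              (M k (γ s).1 (γ s).2).real (Rel k m F η u D) ≤
                C * ((D : ℝ) * η / min ℓ 1) ^ (1 + b) * min ℓ 1 ^ c) :
    ∃ b C η₀ : ℝ, 0 < b ∧ 0 < η₀ ∧ ∀ (s : unitInterval), ∀ η ∈ Set.Ioo (0 : ℝ) η₀, ∀ (D : ℕ),
      1 ≤ D → (D : ℝ) * η < 1 → ∀ U : Finset (Site 2),
        ∑ u ∈ U.filter (fun u => bdist k m F η u < 2 * D * η),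
          (M k (γ s).1 (γ s).2).real (Rel k m F η u D) ≤ C * (D : ℝ) ^ 2 * ((D : ℝ) * η) ^ b := by
  obtain ⟨L, η₁, hη₁, hL⟩ := hcount
  obtain ⟨c₁, C₁, η₂, hc₁, hη₂, hC₁⟩ := hcorner
  obtain ⟨b, c₂, C₂, η₃, hb, hc₂, hη₃, hC₂⟩ := htwo
  -- nonnegative majorants of the constants
  obtain ⟨L', hL'⟩ : ∃ x : ℝ, x = max L 0 := ⟨_, rfl⟩
  obtain ⟨C₁', hC₁'⟩ : ∃ x : ℝ, x = max C₁ 0 := ⟨_, rfl⟩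
  obtain ⟨C₂', hC₂'⟩ : ∃ x : ℝ, x = max C₂ 0 := ⟨_, rfl⟩
  obtain ⟨hL'0, hLle⟩ : 0 ≤ L' ∧ L ≤ L' := ⟨hL' ▸ le_max_right _ _, hL' ▸ le_max_left _ _⟩
  obtain ⟨hC₁'0, hC₁le⟩ : 0 ≤ C₁' ∧ C₁ ≤ C₁' := ⟨hC₁' ▸ le_max_right _ _, hC₁' ▸ le_max_left _ _⟩
  obtain ⟨hC₂'0, hC₂le⟩ : 0 ≤ C₂' ∧ C₂ ≤ C₂' := ⟨hC₂' ▸ le_max_right _ _, hC₂' ▸ le_max_left _ _⟩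
  -- exponents, the geometric ratio and the final constant
  obtain ⟨c', hc'def⟩ : ∃ x : ℝ, x = min c₂ (b / 2) := ⟨_, rfl⟩
  obtain ⟨hc'0, hc'c₂, hc'b⟩ : 0 < c' ∧ c' ≤ c₂ ∧ c' ≤ b / 2 :=
    ⟨hc'def ▸ lt_min hc₂ (half_pos hb), hc'def ▸ min_le_left _ _, hc'def ▸ min_le_right _ _⟩
  obtain ⟨σ, hσdef⟩ : ∃ x : ℝ, x = c' - b := ⟨_, rfl⟩
  have hσ : σ < 0 := by rw [hσdef]; linarith
  obtain ⟨β, hβdef⟩ : ∃ x : ℝ, x = min c₁ c' := ⟨_, rfl⟩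
  obtain ⟨hβ0, hβc₁, hβc'⟩ : 0 < β ∧ β ≤ c₁ ∧ β ≤ c' :=
    ⟨hβdef ▸ lt_min hc₁ hc'0, hβdef ▸ min_le_left _ _, hβdef ▸ min_le_right _ _⟩
  have hβb : β ≤ b := by linarith
  have hA0 : 0 < A := by linarith
  obtain ⟨q, hqdef⟩ : ∃ x : ℝ, x = (2 : ℝ) ^ σ := ⟨_, rfl⟩
  obtain ⟨hq0, hq1⟩ : 0 ≤ q ∧ q < 1 := ⟨hqdef ▸ Real.rpow_nonneg (by norm_num) _,
    hqdef ▸ Real.rpow_lt_one_of_one_lt_of_neg (by norm_num) hσ⟩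
  have h1q : 0 < 1 - q := by linarith
  obtain ⟨K, hKdef⟩ : ∃ x : ℝ,
      x = L' * A * C₁' + L' * C₂' + 2 * L' * C₂' * A ^ σ * (1 - q)⁻¹ := ⟨_, rfl⟩
  refine ⟨β, K, min (min η₁ η₂) η₃, hβ0, lt_min (lt_min hη₁ hη₂) hη₃,
    fun s η hη D hD hDη U => ?_⟩
  have hη0 : 0 < η := hη.1
  have hηne : η ≠ 0 := hη0.ne'
  obtain ⟨⟨h₁, h₂⟩, h₃⟩ := (lt_min_iff.1 hη.2).imp_left lt_min_iff.1
  have hD0 : (0 : ℝ) < D := by exact_mod_cast hD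
  obtain ⟨x, hxdef⟩ : ∃ y : ℝ, y = (D : ℝ) * η := ⟨_, rfl⟩
  have hx0 : 0 < x := by rw [hxdef]; positivity
  have hx1 : x < 1 := hxdef ▸ hDη
  have hAx : 2 * (D : ℝ) * η ≤ A * D * η := by nlinarith [mul_pos hD0 hη0]
  have ha0 : 0 < A * D * η := by positivity
  -- shorthands: the boundary blocks `S`, the level `ℓf u = infDist(η·z(k•u), P)`
  set S := U.filter (fun u => bdist k m F η u < 2 * D * η) with hS
  obtain ⟨ℓf, hℓf⟩ : ∃ g : Site 2 → ℝ,
      g = fun u => Metric.infDist ((η : ℂ) * squareLatticeEmbedding.z (ctr k u)) (P : Set ℂ) :=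
    ⟨_, rfl⟩
  -- the four inputs of the abstract summation
  have hcount' : ∀ t : ℝ, A * D * η ≤ t →
      ((S.filter (fun u => ℓf u < t)).card : ℝ) ≤ L' * D * η⁻¹ * min t 1 := by
    intro t ht
    have hsub : S.filter (fun u => ℓf u < t) ⊆ U.filter (fun u => bdist k m F η u < 2 * D * η ∧
          Metric.infDist ((η : ℂ) * squareLatticeEmbedding.z (ctr k u)) (P : Set ℂ) < t) := by
      intro u hu
      simp only [hS, hℓf, Finset.mem_filter] at hu ⊢
      exact ⟨hu.1.1, hu.1.2, hu.2⟩
    have hmin0 : 0 ≤ min t 1 := le_min (ha0.le.trans ht) zero_le_one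
    calc ((S.filter (fun u => ℓf u < t)).card : ℝ)
        ≤ ((U.filter (fun u => bdist k m F η u < 2 * D * η ∧
            Metric.infDist ((η : ℂ) * squareLatticeEmbedding.z (ctr k u)) (P : Set ℂ) < t)).card :
            ℝ) := by
          exact_mod_cast Finset.card_le_card hsub
      _ ≤ L * D * η⁻¹ * min t 1 := hL η ⟨hη0, h₁⟩ D hD hDη t (hAx.trans ht) U
      _ ≤ L' * D * η⁻¹ * min t 1 :=
          mul_le_mul_of_nonneg_right (mul_le_mul_of_nonneg_right
            (mul_le_mul_of_nonneg_right hLle hD0.le) (inv_nonneg.2 hη0.le)) hmin0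
  have hbS : ∀ u ∈ S, bdist k m F η u < 2 * D * η := fun u hu => by
    rw [hS] at hu; exact (Finset.mem_filter.1 hu).2
  have hin' : ∀ u ∈ S, ℓf u < A * D * η →
      (M k (γ s).1 (γ s).2).real (Rel k m F η u D) ≤ C₁' * x ^ c₁ := by
    intro u hu hlt
    rw [hℓf] at hlt
    calc (M k (γ s).1 (γ s).2).real (Rel k m F η u D) ≤ C₁ * ((D : ℝ) * η) ^ c₁ :=
          hC₁ s η ⟨hη0, h₂⟩ D hD hDη u (hbS u hu) hlt
      _ ≤ C₁' * x ^ c₁ := by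
          rw [hxdef]
          exact mul_le_mul_of_nonneg_right hC₁le (Real.rpow_nonneg (by positivity) _)
  have hfar' : ∀ u ∈ S, A * D * η ≤ ℓf u → 1 ≤ ℓf u →
      (M k (γ s).1 (γ s).2).real (Rel k m F η u D) ≤ C₂' * x ^ (1 + b) := by
    intro u hu h1 h2
    rw [hℓf] at h1 h2
    have h := hC₂ s η ⟨hη0, h₃⟩ D hD hDη (max (A * D * η) 1) (le_max_left _ _) u (hbS u hu)
      (max_le h1 h2)
    rw [min_eq_right (le_max_right _ _), div_one, Real.one_rpow, mul_one] at h
    calc (M k (γ s).1 (γ s).2).real (Rel k m F η u D) ≤ C₂ * ((D : ℝ) * η) ^ (1 + b) := h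
      _ ≤ C₂' * x ^ (1 + b) := by
          rw [hxdef]
          exact mul_le_mul_of_nonneg_right hC₂le (Real.rpow_nonneg (by positivity) _)
  have hmid' : ∀ t : ℝ, A * D * η ≤ t → t < 1 → ∀ u ∈ S, t ≤ ℓf u →
      (M k (γ s).1 (γ s).2).real (Rel k m F η u D) ≤ C₂' * x ^ (1 + b) * t ^ (σ - 1) := by
    intro t hat ht1 u hu htu
    rw [hℓf] at htu
    have ht0 : 0 < t := lt_of_lt_of_le ha0 hat
    have h := hC₂ s η ⟨hη0, h₃⟩ D hD hDη t hat u (hbS u hu) htu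
    rw [min_eq_left ht1.le] at h
    calc (M k (γ s).1 (γ s).2).real (Rel k m F η u D) ≤ C₂ * (x / t) ^ (1 + b) * t ^ c₂ := by
          rw [hxdef]; exact h
      _ ≤ C₂' * (x / t) ^ (1 + b) * t ^ c₂ :=
          mul_le_mul_of_nonneg_right (mul_le_mul_of_nonneg_right hC₂le
            (Real.rpow_nonneg (by positivity) _)) (Real.rpow_nonneg ht0.le _)
      _ ≤ C₂' * (x / t) ^ (1 + b) * t ^ c' :=
          mul_le_mul_of_nonneg_left (Real.rpow_le_rpow_of_exponent_ge ht0 ht1.le hc'c₂)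
            (by positivity)
      _ = C₂' * x ^ (1 + b) * t ^ (σ - 1) := by
          rw [Real.div_rpow hx0.le ht0.le, hσdef, show c' - b - 1 = c' - (1 + b) by ring,
            Real.rpow_sub ht0 c' (1 + b)]
          ring
  -- the abstract summation
  have key := sum_le_of_twoScale_count S (fun u => (M k (γ s).1 (γ s).2).real (Rel k m F η u D))
    ℓf (fun u _ => measureReal_nonneg) (fun u _ => by rw [hℓf]; exact Metric.infDist_nonneg) ha0
    (show 0 ≤ L' * D * η⁻¹ by positivity) (show 0 ≤ C₁' * x ^ c₁ by positivity)
    (show 0 ≤ C₂' * x ^ (1 + b) by positivity) (show 0 ≤ C₂' * x ^ (1 + b) by positivity) hσ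
    hcount' hin' hfar' hmid'
  rw [← hqdef] at key
  -- algebra: the three terms are `K₁ D² x^{c₁}`, `K₂ D² x^b`, `K₃ D² x^{c'}`
  have eA : (D : ℝ) * η⁻¹ * (A * D * η) = A * (D : ℝ) ^ 2 := by field_simp
  have eB : (D : ℝ) * η⁻¹ * x ^ (1 + b) = (D : ℝ) ^ 2 * x ^ b := by
    rw [Real.rpow_add hx0, Real.rpow_one, hxdef]
    field_simp
  have eC : (D : ℝ) * η⁻¹ * (x ^ (1 + b) * (A * D * η) ^ σ) = A ^ σ * (D : ℝ) ^ 2 * x ^ c' := by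
    rw [show A * (D : ℝ) * η = A * x by rw [hxdef]; ring, Real.mul_rpow hA0.le hx0.le,
      show x ^ (1 + b) * (A ^ σ * x ^ σ) = A ^ σ * (x ^ (1 + b) * x ^ σ) by ring,
      ← Real.rpow_add hx0, show 1 + b + σ = 1 + c' by rw [hσdef]; ring, Real.rpow_add hx0,
      Real.rpow_one, hxdef]
    field_simp
  have hxβ : ∀ e, β ≤ e → x ^ e ≤ x ^ β := fun e => Real.rpow_le_rpow_of_exponent_ge hx0 hx1.le
  calc ∑ u ∈ S, (M k (γ s).1 (γ s).2).real (Rel k m F η u D)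
      ≤ L' * D * η⁻¹ * (A * D * η) * (C₁' * x ^ c₁) + L' * D * η⁻¹ * (C₂' * x ^ (1 + b)) +
          2 * (L' * D * η⁻¹) * (C₂' * x ^ (1 + b)) * (A * D * η) ^ σ * (1 - q)⁻¹ := key
    _ = L' * C₁' * ((D : ℝ) * η⁻¹ * (A * D * η)) * x ^ c₁ +
          L' * C₂' * ((D : ℝ) * η⁻¹ * x ^ (1 + b)) +
          2 * L' * C₂' * (1 - q)⁻¹ * ((D : ℝ) * η⁻¹ * (x ^ (1 + b) * (A * D * η) ^ σ)) := by ring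
    _ = L' * A * C₁' * (D : ℝ) ^ 2 * x ^ c₁ + L' * C₂' * (D : ℝ) ^ 2 * x ^ b +
          2 * L' * C₂' * A ^ σ * (1 - q)⁻¹ * (D : ℝ) ^ 2 * x ^ c' := by
        rw [eA, eB, eC]
        ring
    _ ≤ L' * A * C₁' * (D : ℝ) ^ 2 * x ^ β + L' * C₂' * (D : ℝ) ^ 2 * x ^ β +
          2 * L' * C₂' * A ^ σ * (1 - q)⁻¹ * (D : ℝ) ^ 2 * x ^ β := by
        exact add_le_add (add_le_add (mul_le_mul_of_nonneg_left (hxβ c₁ hβc₁) (by positivity))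
          (mul_le_mul_of_nonneg_left (hxβ b hβb) (by positivity)))
          (mul_le_mul_of_nonneg_left (hxβ c' hβc') (by positivity))
    _ = K * (D : ℝ) ^ 2 * ((D : ℝ) * η) ^ β := by rw [hKdef, hxdef]; ring

end Summit.CriticalPhenomena.CardyFormulaZ2.Theorems.CardySelfRefinement.FarField

end
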